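import Summits.HodgeConjecture.HodgeConjecture.Theses.PadicSemiregularLift
import Summits.HodgeConjecture.HodgeConjecture.Theorems.PadicSemiregularLiftHodgeBeyondAnchorsMotivatedSplit
import Summits.HodgeConjecture.HodgeConjecture.Theorems.HodgeBeyondAnchors.Negative.FalseWithoutIsSmoothProjective
import Literature.AlgebraicGeometry.HodgeTheory.HodgeLocus
import Literature.AlgebraicGeometry.HodgeTheory.GlobalInvariantCycles
import Literature.AlgebraicGeometry.HodgeTheory.MotivatedClassesTransport

/-!
# Line `andre-variational` for crux `HodgeBeyondAnchors` (stmt-HodgeConjecture-14054) — skeleton (strategist q1, 2026-08-17)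

Crux-strategist line (planner-cstrat-stmt-HodgeConjecture-14054-q1-0), route `PadicSemiregularLift`.
The crux is kernel-checked EQUIVALENT to the summit with no hypothesis
(`Theorems/…HodgeBeyondAnchorsUnconditional.lean: hodgeBeyondAnchors_iff_hodgeConjecture_holds`), and the
tree carries André's split `HM → B → Δ → HodgeBeyondAnchors` as a LANDED glue
(`hodgeBeyondAnchors_of_motivated_of_standardConjectureB_of_cupProduct`, p137440; line
`andre_motivated_split`, whose lead works the theorem-grade half Δ). This line REFINES THE OTHER
CONJECTURE-GRADE HALF (HM) = "deep-middle Hodge classes are motivated" along the one axis on which the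
motivated language has an UNCONDITIONAL lever that the algebraic language lacks: DEFORMATION.
For algebraic classes the variational Hodge conjecture is open; for MOTIVATED classes it is André's
deformation theorem (Publ. IHÉS 83 (1996) Thm 0.5, the motivic reading of Deligne's theorem of the fixed
part), stated in the tree as the named fact `Andre1996_deformation` (global-class form) with proved steps in
`Literature/…/MotivatedClassesDeformation*.lean`. On the real carriers of `HodgeTheory/HodgeLocus.lean`
(fibre classes `FiberClass f (2p)` with the étalé topology of `R²ᵖ f_* ℂ`, the locus of Hodge classes,
its connected components `HodgeLocusComponent f n p`), HM splits EXACTLY (proof `hodgeClassesMotivated_of_variational`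
below, a case split, no sorry) into:

* `stub_deformationOnComponents` (σ1, THEOREM-GRADE in print, L–XL): motivated-ness propagates along every
  connected component of the locus of Hodge classes of a smooth projective family over a smooth
  quasi-projective base — André Thm 0.5 applied over (a resolution of) the component, which is algebraic and
  finite over the base by Cattani–Deligne–Kaplan (JAMS 8 (1995) Thm 1.1) and carries the tautological flat
  section, lifted to a global class of a smooth compactification by Deligne's partie fixe (Hodge II 4.1.1 =
  tree fact `deligne_globalInvariantCycles`).
* `stub_varyingComponentsMeetMotivatedPoints` (σ2, OPEN — "variational density"): every component of the
  locus of Hodge classes (deep middle) along which the FIBRE VARIES (two points with non-isomorphic fibres)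
  contains ONE point whose class is motivated. This is where every known proof lives (Deligne 1982 / André
  0.6.2: Mumford–Tate families of abelian varieties pass through CM points; André 0.6.3: abelian-type points;
  Markman 2025: degeneration to special Weil fourfolds; Noether–Lefschetz components through complete
  intersection classes), now asked for ONE motivated point instead of algebraicity everywhere.
* `stub_absolutelyRigidPairsMotivated` (σ3, OPEN — the honest residue, typed): a deep-middle Hodge class `c`
  on `X` such that in EVERY smooth projective family through `X` the component of `c` lies over fibres all
  isomorphic to `X` (an ABSOLUTELY RIGID pair: first-order, the contraction `H¹(T_X) → H^{p-1,p+1}`,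
  `θ ↦ θ ⌟ c`, is injective on the embedded deformations — Carlson–Griffiths IVHS) is motivated. Contains the
  isolated Hodge points of Calabi–Yau fourfolds ("flux vacua"); no deformation lever applies by definition;
  the only levers on record are arithmetic (is an isolated Hodge point a `ℚ̄`-point? — Voisin 2007 §0; open).
* `stub_lefschetzStandardB` (B, conjecture-grade, verbatim the registered stub of line `andre_motivated_split`
  = item stmt-HodgeConjecture-17489) and `stub_cupProductAlgebraic` (= Δ on the coniveau carrier,
  `Voisin2003_cupProduct_algebraicClasses`, THEOREM-GRADE: Chow's moving lemma, worked by lead c2-0).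

Composition (kernel-checked, sorries only in `stub_*`): `hodgeClassesMotivated_of_variational : σ1 → σ2 → σ3 → HM`
(if `(X, c)` is not absolutely rigid, some good family moves it to a non-isomorphic fibre inside its
component; σ2 gives a motivated point on that component, σ1 carries motivated-ness back to `(t, e^*c)`, and
`map_mem_motivatedClasses_iff_of_iso` to `c`; else σ3), then `HodgeBeyondAnchors_of` through the landed glue.

Disproof.lean honoured (cycle 1, refuter-cdisprove-14054-0; `Negative/FalseWithoutIsSmoothProjective`,
p99636, imported): the only `_false_without_` obstruction is the index coupling `IsSmoothProjective n X`;
every stub keeps it (fibres via `IsSmoothProjectiveFamily.isSmoothProjective`, same `n`). No `-- Targets`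
entry concerns these stubs.
-/

set_option linter.dupNamespace false

noncomputable section

open CategoryTheory AlgebraicGeometry
open Literature.AlgebraicGeometry.Motives Literature.AlgebraicGeometry.HodgeTheory

namespace Summit.HodgeConjecture.HodgeConjecture.Cruxes.HodgeBeyondAnchors.AndreVariational

open Summit.HodgeConjecture.HodgeConjecture.Theses.PadicSemiregularLift
open Summit.HodgeConjecture.HodgeConjecture.Theorems.HodgeBeyondAnchors

/-! ## Vocabulary (real carriers only) -/

/-- A **good family**: a smooth projective family `f : 𝒳 ⟶ S` of relative dimension `n` over a smooth
quasi-projective complex base — the hypotheses of the tree's `deligne_globalInvariantCycles` (Deligne,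
Hodge II 4.1.1) and of Cattani–Deligne–Kaplan. [cite: CattaniDeligneKaplan1995JAMS, §1] -/
def GoodFamily (n : ℕ) {𝒳 S : SchemeOver ℂ} (f : 𝒳 ⟶ S) : Prop :=
  IsSmoothProjectiveFamily f n ∧ IsQuasiProjectiveOver S ∧ Smooth S.hom

/-- The fibre class `(t, e^* c)` of a class `c` on `X` seen on the fibre `𝒳_t ≅ X`. [folklore] -/
def fibreClassAlong {𝒳 S : SchemeOver ℂ} (f : 𝒳 ⟶ S) {X : SchemeOver ℂ} (t : ComplexPoints S)
    (e : fiberOver f t ≅ X) (p : ℕ) (c : complexBetti X (2 * p)) : FiberClass f (2 * p) :=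
  ⟨t, complexBetti.map e.hom (2 * p) c⟩

/-- **Absolutely rigid pair** `(X, c)`: in every good family through `X`, the connected component of the
locus of Hodge classes through `(t, e^* c)` lies over fibres all isomorphic to `X` — the class `c` stays of
Hodge type `(p,p)` along NO deformation of `X` to a non-isomorphic variety (the `0`-dimensional-in-moduli
components of Hodge loci; first order: `θ ↦ θ ⌟ c^{p,p}`, `H¹(T_X) → H^{p-1,p+1}(X)`, injective on embedded
deformations, Carlson–Griffiths). [cite: Voisin2007HodgeLoci, §1] [cite: CattaniDeligneKaplan1995JAMS, §1] -/
def IsAbsolutelyRigid (n : ℕ) (X : SchemeOver ℂ) (p : ℕ) (c : complexBetti X (2 * p)) : Prop :=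
  ∀ ⦃𝒳 S : SchemeOver ℂ⦄ (f : 𝒳 ⟶ S), GoodFamily n f →
    ∀ (t : ComplexPoints S) (e : fiberOver f t ≅ X)
      (hx : fibreClassAlong f t e p c ∈ locusOfHodgeClasses f n p),
      ∀ y ∈ (HodgeLocusComponent.of _ hx).carrier, Nonempty (fiberOver f y.pt ≅ X)

/-! ## Registered stubs -/

/-- **(σ1) Deformation principle for motivated classes along components of the locus of Hodge classes**
(André 1996, Théorème de déformation 0.5, p. 8: "si `ξ_s` est motivée pour un `s ∈ S(ℂ)`, alors `ξ_t` est
motivée pour tout `t`", for global sections over a connected base; here over a CONNECTED COMPONENT `C` of the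
locus of Hodge classes of a good family: if one fibre class of `C` is motivated, all are). Intended proof:
`C` is an algebraic variety finite over `S` (Cattani–Deligne–Kaplan Thm 1.1 / Cor. 1.2); base-change the
family to a resolution `C̃` of `C` (good again: `Motives.familyPullback`,
`IsSmoothProjectiveFamily.familyPullback_snd`); the tautological section is a continuous section of
`FiberClass.pt` over `C̃(ℂ)`, so Deligne's partie fixe (`deligne_globalInvariantCycles`) makes it the global
section of a class of a smooth compactification, and `Andre1996_deformation` (chained over the irreducible
components of `C̃`, `AlgPoints.forall_of_irreducibleComponents`) transports motivated-ness; fibres of the base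
change are identified by `map_fiberι_familyPullback_mem_motivatedClasses_iff`. THEOREM-GRADE in print; L–XL on
the carriers (CDK algebraicity of components is not yet a tree fact).
[cite: Andre1996Motifs, Thm. 0.5 (p. 8) and §5.1] [cite: CattaniDeligneKaplan1995JAMS, Thm. 1.1]
[cite: DeligneHodgeII1971, Théorème 4.1.1] -/
theorem stub_deformationOnComponents :
    ∀ ⦃n : ℕ⦄ ⦃𝒳 S : SchemeOver ℂ⦄ (f : 𝒳 ⟶ S), GoodFamily n f →
      ∀ (p : ℕ) (C : HodgeLocusComponent f n p) ⦃x y : FiberClass f (2 * p)⦄,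
        x ∈ C.carrier → y ∈ C.carrier →
        x.cls ∈ motivatedClasses n (fiberOver f x.pt) p →
        y.cls ∈ motivatedClasses n (fiberOver f y.pt) p := by
  sorry

/-- **(σ2) Variational density** — every component of the locus of Hodge classes of a good family, in the
deep middle `2 ≤ p ≤ n/2`, along which the FIBRE VARIES (two of its points lie over non-isomorphic fibres)
contains a point whose class is MOTIVATED. OPEN; a consequence of HM (hence of HC) — see the `example` at the
end; the statement to which the known mechanisms apply: CM / abelian-type points on Mumford–Tate families
(Deligne 1982 §5–§6, André 0.6.2–0.6.3), special members of Weil families (Markman 2025), complete-intersection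
points of Noether–Lefschetz components. Kill test: a Hodge-locus component, positive-dimensional in moduli, with
NO motivated point. [cite: Andre1996Motifs, Thm. 0.6.2, Thm. 0.6.3] [cite: Deligne1982HodgeCycles, §6]
[cite: arXiv:2502.03415, §1] -/
theorem stub_varyingComponentsMeetMotivatedPoints :
    ∀ ⦃n : ℕ⦄ ⦃𝒳 S : SchemeOver ℂ⦄ (f : 𝒳 ⟶ S), GoodFamily n f →
      ∀ (p : ℕ), 2 ≤ p → 2 * p ≤ n → ∀ (C : HodgeLocusComponent f n p),
        (∃ x ∈ C.carrier, ∃ y ∈ C.carrier, ¬ Nonempty (fiberOver f x.pt ≅ fiberOver f y.pt)) →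
        ∃ z ∈ C.carrier, z.cls ∈ motivatedClasses n (fiberOver f z.pt) p := by
  sorry

/-- **(σ3) Absolutely rigid pairs** — a rational `(p,p)`-class (`2 ≤ p ≤ n/2`) on a smooth projective `X`
that deforms, in every good family, only over fibres isomorphic to `X` (`IsAbsolutelyRigid`) is motivated.
OPEN; the typed residue of HM where no deformation lever exists (isolated Hodge points, e.g. Calabi–Yau
fourfolds with a `(2,2)`-class whose contraction map `H¹(T_X) → H^{1,3}` is injective); levers on record are
arithmetic only (field of definition of isolated points of the Hodge locus: Voisin 2007 Thm 0.5 / Lemma 1.4;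
NOT covered by the level-`≥ 3` `ℚ̄`-definability theorems, which concern positive period dimension). A
consequence of HM (see the `example` at the end), so not stronger than the crux; not HM reworded (the rigidity
hypothesis cannot be discharged for a general pair). [cite: Voisin2007HodgeLoci, Thm. 0.5, Lemma 1.4]
[cite: CattaniDeligneKaplan1995JAMS, Cor. 1.2] -/
theorem stub_absolutelyRigidPairsMotivated :
    ∀ ⦃n : ℕ⦄ ⦃X : SchemeOver ℂ⦄, IsSmoothProjective n X →
      ∀ p : ℕ, 2 ≤ p → 2 * p ≤ n →
        ∀ c : complexBetti X (2 * p), IsRationalClass c → IsOfHodgeType n X (2 * p) p p c →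
          IsAbsolutelyRigid n X p c → c ∈ motivatedClasses n X p := by
  sorry

/-- **(B) The standard conjecture of Lefschetz type, André's `*_L`-form, for every smooth projective
complex variety** — verbatim the registered stub of line `andre_motivated_split` and the crux item
`MotivatedLefschetzSplit.LefschetzStandardB` (stmt-HodgeConjecture-17489). CONJECTURE-GRADE; not worked by
this line. [cite: Andre1996Motifs, §0.2–0.3, Prop. 1.2] [cite: Lieberman1968, Thm. 1] -/
theorem stub_lefschetzStandardB :
    ∀ (d : ℕ) (Z : SchemeOver ℂ) (η : complexBetti Z 2), IsSmoothProjective d Z →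
      StandardConjectureBStar d Z η := by
  sorry

/-- **(Δ, coniveau form) Cup product preserves supported classes: `Nᵃ H²ᵃ ∪ Nᵇ H²ᵇ ⊆ Nᵃ⁺ᵇ H²⁽ᵃ⁺ᵇ⁾`**
on a smooth projective complex variety — the tree's named fact `Voisin2003_cupProduct_algebraicClasses`
(Voisin II Prop. 9.20 via Chow's moving lemma; Fulton §8.3), kernel-checked EQUIVALENT to (Δ)
`DiagonalPullbackAlgebraic` (stmt-HodgeConjecture-17490) by `diagonalPullbackAlgebraic_iff_cupProduct`
(p137440), and reduced in the tree to the cone step of the moving lemma (lead c2-0, ROBERTS-PLAN.md).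
THEOREM-GRADE; not worked by this line. [cite: VoisinHodgeII2003, Prop. 9.20, Lemma 9.22]
[cite: Fulton1998, §11.4 Ex. 11.4.1] -/
theorem stub_cupProductAlgebraic : Voisin2003_cupProduct_algebraicClasses := by
  sorry

/-! ## Stub statements by name: `Sig.stub_<name> : Prop` (the admissible hypotheses of the HM glue)

As in the birth skeletons of this sub-problem (`Cruxes/AbsoluteReduction/Lines/birth.lean`): the statement of
each stub consumed by an intermediate glue theorem, restated as a named `Prop` whose last name component is the
stub's own name; the `example`s pin each restatement to its stub definitionally. -/

/-- The statement of `stub_deformationOnComponents`, verbatim. [cite: Andre1996Motifs, Thm. 0.5] -/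
def Sig.stub_deformationOnComponents : Prop :=
  ∀ ⦃n : ℕ⦄ ⦃𝒳 S : SchemeOver ℂ⦄ (f : 𝒳 ⟶ S), GoodFamily n f →
    ∀ (p : ℕ) (C : HodgeLocusComponent f n p) ⦃x y : FiberClass f (2 * p)⦄,
      x ∈ C.carrier → y ∈ C.carrier →
      x.cls ∈ motivatedClasses n (fiberOver f x.pt) p →
      y.cls ∈ motivatedClasses n (fiberOver f y.pt) p

/-- The statement of `stub_varyingComponentsMeetMotivatedPoints`, verbatim. [cite: Andre1996Motifs, Thm. 0.6.2] -/
def Sig.stub_varyingComponentsMeetMotivatedPoints : Prop :=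
  ∀ ⦃n : ℕ⦄ ⦃𝒳 S : SchemeOver ℂ⦄ (f : 𝒳 ⟶ S), GoodFamily n f →
    ∀ (p : ℕ), 2 ≤ p → 2 * p ≤ n → ∀ (C : HodgeLocusComponent f n p),
      (∃ x ∈ C.carrier, ∃ y ∈ C.carrier, ¬ Nonempty (fiberOver f x.pt ≅ fiberOver f y.pt)) →
      ∃ z ∈ C.carrier, z.cls ∈ motivatedClasses n (fiberOver f z.pt) p

/-- The statement of `stub_absolutelyRigidPairsMotivated`, verbatim. [cite: Voisin2007HodgeLoci, §1] -/
def Sig.stub_absolutelyRigidPairsMotivated : Prop :=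
  ∀ ⦃n : ℕ⦄ ⦃X : SchemeOver ℂ⦄, IsSmoothProjective n X →
    ∀ p : ℕ, 2 ≤ p → 2 * p ≤ n →
      ∀ c : complexBetti X (2 * p), IsRationalClass c → IsOfHodgeType n X (2 * p) p p c →
        IsAbsolutelyRigid n X p c → c ∈ motivatedClasses n X p

/-- `Sig.stub_deformationOnComponents` IS the type of the stub (definitional). -/
example : Sig.stub_deformationOnComponents := stub_deformationOnComponents

/-- `Sig.stub_varyingComponentsMeetMotivatedPoints` IS the type of the stub (definitional). -/
example : Sig.stub_varyingComponentsMeetMotivatedPoints := stub_varyingComponentsMeetMotivatedPoints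

/-- `Sig.stub_absolutelyRigidPairsMotivated` IS the type of the stub (definitional). -/
example : Sig.stub_absolutelyRigidPairsMotivated := stub_absolutelyRigidPairsMotivated

/-! ## Kernel-checked composition -/

/-- **HM from the variational trichotomy** (glue, no sorry): a deep-middle rational `(p,p)`-class `c` on
`X` is motivated — if `(X, c)` is absolutely rigid by (σ3); otherwise some good family `f`, `e : 𝒳_t ≅ X`,
moves `(t, e^*c)` inside its component `C` of the locus of Hodge classes to a point `y` with `𝒳_{y} ≄ X`,
so `C` varies, (σ2) gives a motivated point `z ∈ C`, (σ1) carries motivated-ness from `z` to `(t, e^*c)`,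
and `map_mem_motivatedClasses_iff_of_iso` (André Prop. 2.1, tree) from `e^*c` to `c`.
[cite: Andre1996Motifs, Thm. 0.5, Prop. 2.1] -/
theorem hodgeClassesMotivated_of_variational (h₁ : Sig.stub_deformationOnComponents)
    (h₂ : Sig.stub_varyingComponentsMeetMotivatedPoints) (h₃ : Sig.stub_absolutelyRigidPairsMotivated) :
    ∀ ⦃n : ℕ⦄ ⦃X : SchemeOver ℂ⦄, IsSmoothProjective n X →
      ∀ p : ℕ, 2 ≤ p → 2 * p ≤ n →
        ∀ c : complexBetti X (2 * p), IsRationalClass c → IsOfHodgeType n X (2 * p) p p c →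
          c ∈ motivatedClasses n X p := by
  intro n X hX p hp2 hpn c hc hpp
  by_cases hR : IsAbsolutelyRigid n X p c
  · exact h₃ hX p hp2 hpn c hc hpp hR
  · unfold IsAbsolutelyRigid at hR
    push Not at hR
    obtain ⟨𝒳, S, f, hf, t, e, hx, y, hy, hyX⟩ := hR
    have hx₀ : fibreClassAlong f t e p c ∈ (HodgeLocusComponent.of _ hx).carrier :=
      HodgeLocusComponent.mem_carrier_of hx
    have hvar : ¬ Nonempty (fiberOver f (fibreClassAlong f t e p c).pt ≅ fiberOver f y.pt) := by
      rintro ⟨i⟩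
      exact hyX.false (i.symm ≪≫ e)
    obtain ⟨z, hz, hzm⟩ := h₂ f hf p hp2 hpn _ ⟨_, hx₀, y, hy, hvar⟩
    have hm := h₁ f hf p _ hz hx₀ hzm
    exact (map_mem_motivatedClasses_iff_of_iso hX (hf.1.isSmoothProjective t) e c).1 hm

/-- **The crux from the line**: (σ1)+(σ2)+(σ3) give HM, then the LANDED glue
`hodgeBeyondAnchors_of_motivated_of_standardConjectureB_of_cupProduct : HM → B → (Δ-cup) → HodgeBeyondAnchors`
(p137440). [cite: Andre1996Motifs, §2.1] -/
theorem HodgeBeyondAnchors_of : HodgeBeyondAnchors :=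
  hodgeBeyondAnchors_of_motivated_of_standardConjectureB_of_cupProduct
    (hodgeClassesMotivated_of_variational stub_deformationOnComponents
      stub_varyingComponentsMeetMotivatedPoints stub_absolutelyRigidPairsMotivated)
    stub_lefschetzStandardB stub_cupProductAlgebraic

/-! ## Consistency: (σ2) and (σ3) are consequences of HM (hence of the summit) -/

/-- (σ2) and (σ3) follow from HM (every deep-middle Hodge class is motivated), so neither is STRONGER than
the crux (HM itself follows from the summit: `hodgeClassesMotivated_of_hodgeConjecture`); (σ1) is a theorem
in print. [cite: Andre1996Motifs, §2.1] -/
example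
    (hM : ∀ ⦃n : ℕ⦄ ⦃X : SchemeOver ℂ⦄, IsSmoothProjective n X →
      ∀ p : ℕ, 2 ≤ p → 2 * p ≤ n →
        ∀ c : complexBetti X (2 * p), IsRationalClass c → IsOfHodgeType n X (2 * p) p p c →
          c ∈ motivatedClasses n X p) :
    Sig.stub_varyingComponentsMeetMotivatedPoints ∧ Sig.stub_absolutelyRigidPairsMotivated := by
  refine ⟨fun n 𝒳 S f hf p hp2 hpn C _ ↦ ?_, fun n X hX p hp2 hpn c hc hpp _ ↦ hM hX p hp2 hpn c hc hpp⟩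
  obtain ⟨z, hz⟩ := C.carrier_nonempty
  have hzL := C.carrier_subset hz
  exact ⟨z, hz, hM (hf.1.isSmoothProjective z.pt) p hp2 hpn z.cls hzL.1 hzL.2⟩

end Summit.HodgeConjecture.HodgeConjecture.Cruxes.HodgeBeyondAnchors.AndreVariational

end
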